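import Summits.Ventures.HSemireg.ObstructionLocusCrossingExtAllDegrees

/-!
# Venture HSemireg — (S5) OBSTRUCTION LOCUS away from secant type, XLVI: the DICTIONARY between the partial branch
# tuples of files XLIII/XLIV and the index sets of files XIX/XXIX (degree `1`: branches) and XXXVII (degree `r`: branch
# tuples) — file XLIV's `extEquiv` in degrees `1` and `r` has the targets of `extOneEquivBlocks` and `extTopEquiv`

HONEST FRAMING.  Part of the Lean side of the computation cell `pub-hsemireg` (track «S4-PUSH» (ii), seat
s4-prove-2).  Finite combinatorics on top of files XIX (`Branch`, `BranchFunctions`), XXXVII (`BranchTuple`,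
`tupleIdeal`), XLIII (`PBT`, `ptupleIdeal`) and XLIV (`extEquiv`).  Nothing here constructs a variety or a sheaf;
nothing here says that HC / HC_CM / HC_AV holds; no Literature fact is declared or used; no object is certified.

CONTENT.  `ptupleSingle` (the partial tuple with one datum), `pdeg_ptupleSingle`, `ptupleIdeal_ptupleSingle`,
`eq_ptupleSingle_of_pdeg_eq_one` (a degree-`1` tuple IS a single datum), `sigmaToBranch` ∕ `branchToSigma`,
**`pbtOneEquiv : PBT B 1 ≃ Branch B`**,
**`pbtOneQuotPiEquiv : Π_{PBT B 1} R ⧸ J_τ ≃ₗ[R] BranchFunctions K B`**, hence **`extOneEquivPBT`**: file XLIV's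
`extEquiv B 1` composed to `Ext¹_R(I_M, I_M) ≃ₗ[R] BranchFunctions K B` (the TARGET of file XXIX's `extOneEquivBlocks`;
the two chosen equivalences are not claimed equal); and in top degree `isSome_of_pdeg_eq_card`, **`pbtTopEquiv :
PBT B (card ι) ≃ BranchTuple B`**, `ptupleIdeal_some_comp` (`J_{some ∘ t} = J_t`), **`pbtTopQuotPiEquiv`**, hence
**`extTopEquivPBT`** with the target of file XXXVII's `extTopEquiv`.  With file XLV: `#PBT(M, 1) = Σ_i |S_i|(|S_i| − 1) =
#Branch` and `#PBT(M, r) = Π_i |S_i|(|S_i| − 1) = #BranchTuple` are the two ends of `card_pbt`.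
References (dictionary only): EXT-NOTE.md §6.B(b)(c).
-/

open CategoryTheory CategoryTheory.Abelian MvPolynomial Finset
open scoped BigOperators

universe u

namespace Summit.Ventures.HSemireg.ObstructionLocus.BlockModel

variable {K : Type u} [CommRing K] {n : ℕ} {ι : Type} [Fintype ι] [DecidableEq ι] (B : Blocks ι n)

/-! ## Degree `1`: partial tuples with one datum are branches -/

section One

/-- The partial tuple with the single datum `t` at block `i`. -/
def ptupleSingle (i : ι) (t : Br B i) : PTuple B :=
  Function.update (fun j => (none : Option (Br B j))) i (some t)

omit [Fintype ι] in
/-- Its value at `i`. -/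
@[simp] theorem ptupleSingle_self (i : ι) (t : Br B i) : ptupleSingle B i t i = some t := by
  simp [ptupleSingle]

omit [Fintype ι] in
/-- Its value off `i`. -/
@[simp] theorem ptupleSingle_of_ne (i : ι) (t : Br B i) {j : ι} (h : j ≠ i) : ptupleSingle B i t j = none := by
  simp [ptupleSingle, h]

/-- It has degree `1`. -/
theorem pdeg_ptupleSingle (i : ι) (t : Br B i) : pdeg B (ptupleSingle B i t) = 1 := by
  rw [pdeg, Fintype.sum_eq_add_sum_subtype_ne _ i, ptupleSingle_self, owt_some,
    Finset.sum_eq_zero fun j _ => by rw [ptupleSingle_of_ne B i t j.2, owt_none], add_zero]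

omit [Fintype ι] in
/-- Its ideal is `(x_b, x_a)`. -/
theorem ptupleIdeal_ptupleSingle (i : ι) (t : Br B i) :
    ptupleIdeal K B (ptupleSingle B i t) = Ideal.span {(X t.1.2.2 : MvPolynomial (Fin n) K), X t.1.2.1} := by
  rw [ptupleIdeal, iSup_split_single _ i, ptupleSingle_self, optIdeal_some]
  refine le_antisymm (sup_le le_rfl (iSup₂_le fun j hj => ?_)) le_sup_left
  rw [ptupleSingle_of_ne B i t hj, optIdeal_none]
  exact bot_le

/-- **A partial tuple of degree `1` is a single datum.** -/
theorem eq_ptupleSingle_of_pdeg_eq_one {τ : PTuple B} (hτ : pdeg B τ = 1) {i : ι} {t : Br B i} (hi : τ i = some t) :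
    τ = ptupleSingle B i t := by
  have hsum : ∑ j : {j // j ≠ i}, owt (τ j.1) = 0 := by
    have h := hτ
    rw [pdeg, Fintype.sum_eq_add_sum_subtype_ne _ i, hi, owt_some] at h
    omega
  funext j
  by_cases hj : j = i
  · subst hj
    rw [hi, ptupleSingle_self]
  · rw [ptupleSingle_of_ne B i t hj]
    have h0 := (Finset.sum_eq_zero_iff.1 hsum) ⟨j, hj⟩ (Finset.mem_univ _)
    cases h' : τ j with
    | none => rfl
    | some t' => rw [h'] at h0; simp at h0

omit [DecidableEq ι] in
/-- A partial tuple of degree `1` has a datum somewhere. -/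
theorem exists_eq_some_of_pdeg_eq_one {τ : PTuple B} (hτ : pdeg B τ = 1) : ∃ i t, τ i = some t := by
  by_contra h
  push Not at h
  have : pdeg B τ = 0 := Finset.sum_eq_zero fun j _ => by
    cases h' : τ j with
    | none => rfl
    | some t => exact absurd h' (h j t)
  omega

/-- The block carrying the datum of a degree-`1` tuple (chosen). -/
noncomputable def pbtOneIndex (τ : PBT B 1) : ι := (exists_eq_some_of_pdeg_eq_one B τ.2).choose

/-- The datum of a degree-`1` tuple. -/
noncomputable def pbtOneDatum (τ : PBT B 1) : Br B (pbtOneIndex B τ) :=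
  (exists_eq_some_of_pdeg_eq_one B τ.2).choose_spec.choose

omit [DecidableEq ι] in
/-- The defining property of the chosen block and datum. -/
theorem pbtOne_spec (τ : PBT B 1) : τ.1 (pbtOneIndex B τ) = some (pbtOneDatum B τ) :=
  (exists_eq_some_of_pdeg_eq_one B τ.2).choose_spec.choose_spec

/-- A degree-`1` tuple is the single tuple of its datum. -/
theorem pbtOne_eq (τ : PBT B 1) : τ.1 = ptupleSingle B (pbtOneIndex B τ) (pbtOneDatum B τ) :=
  eq_ptupleSingle_of_pdeg_eq_one B τ.2 (pbtOne_spec B τ)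

omit [Fintype ι] in
/-- Single tuples are equal only for equal blocks and data. -/
theorem ptupleSingle_inj {i i' : ι} {t : Br B i} {t' : Br B i'} (h : ptupleSingle B i t = ptupleSingle B i' t') :
    (⟨i, t⟩ : Σ j, Br B j) = ⟨i', t'⟩ := by
  have hi : i = i' := by
    by_contra hne
    have h1 := congrFun h i
    rw [ptupleSingle_self, ptupleSingle_of_ne B i' t' hne] at h1
    exact Option.some_ne_none t h1
  subst hi
  have h1 := congrFun h i
  rw [ptupleSingle_self, ptupleSingle_self] at h1
  cases h1
  rfl

/-- A block with a datum, as file XIX's branch `(i, a, b)`. -/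
def sigmaToBranch (p : Σ j, Br B j) : Branch B := ⟨(p.1, p.2.1.2), p.2.2⟩

/-- File XIX's branch `(i, a, b)` as a block with a datum. -/
def branchToSigma (t : Branch B) : Σ j, Br B j := ⟨t.1.1, ⟨((), t.1.2), t.2⟩⟩

/-- **`PBT B 1 ≃ Branch B`**: partial tuples on one block are file XIX's branch data `(i, a, b)`. -/
noncomputable def pbtOneEquiv : PBT B 1 ≃ Branch B where
  toFun τ := sigmaToBranch B ⟨pbtOneIndex B τ, pbtOneDatum B τ⟩
  invFun t := ⟨ptupleSingle B (branchToSigma B t).1 (branchToSigma B t).2, pdeg_ptupleSingle B _ _⟩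
  left_inv τ := Subtype.ext (pbtOne_eq B τ).symm
  right_inv t := by
    have h : ptupleSingle B (pbtOneIndex B ⟨ptupleSingle B (branchToSigma B t).1 (branchToSigma B t).2,
          pdeg_ptupleSingle B _ _⟩) (pbtOneDatum B ⟨ptupleSingle B (branchToSigma B t).1 (branchToSigma B t).2,
          pdeg_ptupleSingle B _ _⟩) =
        ptupleSingle B (branchToSigma B t).1 (branchToSigma B t).2 :=
      (pbtOne_eq B _).symm
    change sigmaToBranch B ⟨_, _⟩ = t
    rw [ptupleSingle_inj B h]
    rfl

/-- The ideal along the dictionary: `J_τ = (x_b, x_a)` for the branch `(i, a, b)` of `τ`. -/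
theorem ptupleIdeal_eq_span_pbtOneEquiv (τ : PBT B 1) :
    ptupleIdeal K B τ.1 =
      Ideal.span {(X (pbtOneEquiv B τ).1.2.2 : MvPolynomial (Fin n) K), X (pbtOneEquiv B τ).1.2.1} := by
  conv_lhs => rw [pbtOne_eq B τ]
  rw [ptupleIdeal_ptupleSingle]
  rfl

/-- **`Π_{τ ∈ PBT(M, 1)} R ⧸ J_τ ≃ₗ[R] BranchFunctions K B`** (file XIX's `Π_{(i,a,b)} R ⧸ (x_b, x_a)`). -/
noncomputable def pbtOneQuotPiEquiv :
    ((τ : PBT B 1) → MvPolynomial (Fin n) K ⧸ ptupleIdeal K B τ.1) ≃ₗ[MvPolynomial (Fin n) K] BranchFunctions K B :=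
  (LinearEquiv.piCongrRight fun τ => Submodule.quotEquivOfEq _ _ (ptupleIdeal_eq_span_pbtOneEquiv (K := K) B τ)).trans
    (LinearEquiv.piCongrLeft (MvPolynomial (Fin n) K)
      (fun t : Branch B => MvPolynomial (Fin n) K ⧸ Ideal.span {(X t.1.2.2 : MvPolynomial (Fin n) K), X t.1.2.1})
      (pbtOneEquiv B))

/-- **File XLIV in degree `1` with file XXIX's target: `Ext¹_R(I_M, I_M) ≃ₗ[R] BranchFunctions K B`** (both this and
`extOneEquivBlocks` are chosen ∕ canonical respectively; only the common target is asserted). -/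
noncomputable def extOneEquivPBT :
    Ext.{u} (ModuleCat.of (MvPolynomial (Fin n) K) ↥(arrIdeal K B))
        (ModuleCat.of (MvPolynomial (Fin n) K) ↥(arrIdeal K B)) 1
      ≃ₗ[MvPolynomial (Fin n) K] BranchFunctions K B :=
  (extEquiv (K := K) B 1).trans (pbtOneQuotPiEquiv (K := K) B)

end One

/-! ## Top degree: partial tuples on all blocks are branch tuples -/

section Top

/-- A partial tuple of degree `#blocks` has a datum in every block. -/
theorem isSome_of_pdeg_eq_card {τ : PTuple B} (hτ : pdeg B τ = Fintype.card ι) (i : ι) : (τ i).isSome := by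
  by_contra h
  have hi : owt (τ i) = 0 := by
    cases h' : τ i with
    | none => rfl
    | some t => rw [h'] at h; exact absurd (Option.isSome_some) h
  have hle : ∑ j : {j // j ≠ i}, owt (τ j.1) ≤ Fintype.card {j // j ≠ i} :=
    calc ∑ j : {j // j ≠ i}, owt (τ j.1) ≤ ∑ _j : {j // j ≠ i}, 1 :=
          Finset.sum_le_sum fun j _ => by cases τ j.1 <;> simp
      _ = Fintype.card {j // j ≠ i} := by simp
  have hc : Fintype.card {j // j ≠ i} = Fintype.card ι - 1 := by
    rw [Fintype.card_subtype, Finset.filter_ne', Finset.card_erase_of_mem (Finset.mem_univ _), Finset.card_univ]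
  have h2 := hτ
  rw [pdeg, Fintype.sum_eq_add_sum_subtype_ne _ i, hi, zero_add] at h2
  have hpos : 0 < Fintype.card ι := Fintype.card_pos_iff.2 ⟨i⟩
  omega

omit [DecidableEq ι] in
/-- The all-`some` tuple has degree `#blocks`. -/
theorem pdeg_some_comp (t : BranchTuple B) : pdeg B (fun i => some (t i)) = Fintype.card ι := by
  simp [pdeg, Finset.card_univ]

/-- **`PBT B (#blocks) ≃ BranchTuple B`**: partial tuples on all blocks are file XXXVII's branch tuples. -/
noncomputable def pbtTopEquiv : PBT B (Fintype.card ι) ≃ BranchTuple B where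
  toFun τ i := (τ.1 i).get (isSome_of_pdeg_eq_card B τ.2 i)
  invFun t := ⟨fun i => some (t i), pdeg_some_comp B t⟩
  left_inv τ := Subtype.ext (funext fun i => by simp)
  right_inv t := funext fun i => by simp

omit [Fintype ι] [DecidableEq ι] in
/-- The ideal of an all-`some` tuple is file XXXVII's tuple ideal. -/
theorem ptupleIdeal_some_comp (t : BranchTuple B) : ptupleIdeal K B (fun i => some (t i)) = tupleIdeal K B t := rfl

/-- The ideal along the dictionary. -/
theorem ptupleIdeal_eq_tupleIdeal_pbtTopEquiv (τ : PBT B (Fintype.card ι)) :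
    ptupleIdeal K B τ.1 = tupleIdeal K B (pbtTopEquiv B τ) := by
  rw [← ptupleIdeal_some_comp]
  congr 1
  funext i
  simp [pbtTopEquiv]

/-- **`Π_{τ ∈ PBT(M, r)} R ⧸ J_τ ≃ₗ[R] Π_{t ∈ BranchTuple(M)} R ⧸ J_t`** (file XXXVII's target). -/
noncomputable def pbtTopQuotPiEquiv :
    ((τ : PBT B (Fintype.card ι)) → MvPolynomial (Fin n) K ⧸ ptupleIdeal K B τ.1) ≃ₗ[MvPolynomial (Fin n) K]
      ((t : BranchTuple B) → MvPolynomial (Fin n) K ⧸ tupleIdeal K B t) :=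
  (LinearEquiv.piCongrRight fun τ =>
      Submodule.quotEquivOfEq _ _ (ptupleIdeal_eq_tupleIdeal_pbtTopEquiv (K := K) B τ)).trans
    (LinearEquiv.piCongrLeft (MvPolynomial (Fin n) K)
      (fun t : BranchTuple B => MvPolynomial (Fin n) K ⧸ tupleIdeal K B t) (pbtTopEquiv B))

/-- **File XLIV in top degree with file XXXVII's target: `Ext^r_R(I_M, I_M) ≃ₗ[R] Π_{t ∈ BranchTuple(M)} R ⧸ J_t`**. -/
noncomputable def extTopEquivPBT :
    Ext.{u} (ModuleCat.of (MvPolynomial (Fin n) K) ↥(arrIdeal K B))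
        (ModuleCat.of (MvPolynomial (Fin n) K) ↥(arrIdeal K B)) (Fintype.card ι)
      ≃ₗ[MvPolynomial (Fin n) K] ((t : BranchTuple B) → MvPolynomial (Fin n) K ⧸ tupleIdeal K B t) :=
  (extEquiv (K := K) B (Fintype.card ι)).trans (pbtTopQuotPiEquiv (K := K) B)

end Top

end Summit.Ventures.HSemireg.ObstructionLocus.BlockModel
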